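/-
Copyright (c) 2026 the pub-hodgecm-mathlib formalisation cell (harness21).  Prover seat hodgecm-mathlib-LH4-p12 (g2), Track A «(D-RAM) FOUR-FRAME», unit U2H_HSide, ROW (1)
child (ρ1a): the hΦ DISCHARGE — the type-(1) H-side dictionary in AFFINE form (successor of LH4-p12 (g0)'s (b′) dictionary seat; bricks (4a)(4b) LH4-p07 (g3), (4c) LH4-p12 (g0)).
2026-09-04.
-/
import Summits.HodgeConjecture.HodgeConjecture.Theorems.F0P3cDyRamHSideTypeOneTorusForm     -- ★ p855773 (LH4-p12 (g0)): the (e₀)-twin capstone `exists_hFamily_{zero,one}_eq_mul_two_mul_and_law_of_v_eq_{one,exp_neg_one}`; brings ★ (b′-4) partner, ★ `hFamily_zero∕one`, ★ `hProfileZero_eq_indicator_prod_top`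
import Summits.HodgeConjecture.HodgeConjecture.Theorems.F0P3cDyRamTypeOneTorusConductor    -- ★ p855833 (LH4-p12 (g0)): (4c) `ratio_of_isRoot_of_isRoot`, `valuation_eq_pow_half_of_depth`
import Literature.NumberTheory.Automorphic.SLTwoTreeQuadraticTorusNormalFormSharp           -- ★ p855714 (LH4-p12 (g0)): the torus-form package `exists_torusForm_binders_of_eisenstein_of_deep'`
import Literature.NumberTheory.Automorphic.UnitaryTwoDescentDiscriminantTypeOne             -- ★ p855933 (LH4-p07 (g3)): (4a) `exists_disc_eq_eisenstein_mul_sq_of_typeOne`, (4b) `valuation_disc_le_of_typeOne_of_depth`, `eisenstein_disc_ne_zero`; brings ★ `trace∕det_eq_smul_of_descent`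
import Literature.NumberTheory.Automorphic.UnitaryTwoRamifiedTreeAction                     -- ★ `descent_of_mem_unitaryGroupOfForm_antidiag` (★ (W1) at the place)
import Literature.NumberTheory.Automorphic.UnitaryTwoRamifiedTreeStabilizers                -- ★ `coe_mem_unitaryGroupOfForm_antidiag_two_of_mem_placeForm`
import Literature.NumberTheory.Automorphic.RamifiedPlaceAntiFixedDichotomy                  -- ★ `exists_units_galAdicCompletionMap_complexConj_eq_neg_of_ramified` (anti-fixed unit ∕ uniformiser)
import Literature.NumberTheory.Automorphic.SLTwoTreeProjectiveAction                        -- ★ `isSpecialLattice_latt_of_valuation_det` (the root vertex `latt 1`)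
import Literature.NumberTheory.Automorphic.AdicCompletionResidueCard                        -- ★ `natCard_valuativeResidueField_adicCompletion_eq` (`q_v`, `ValuativeRel` presentation)
import Literature.NumberTheory.Rogawski1990.UnitaryLatticeTreeTameRamifiedCM                -- ★ `natCard_valuedResidueField_eq_of_ramified_CM` (`#k_w = #k_v`, `Valued` presentation)
import Literature.NumberTheory.Rogawski1990.LocalEllipticOfNormOneRoots                     -- ★ p855564 (LH4-p08 (g2)): `not_exists_conj_glDiagonal_of_isRoot_of_norm_one` (ellipticity from the root letters)
import HarnessLib

/-!
# Crux `H413`, line LH4 «(D-RAM) FOUR-FRAME», unit U2H (ii-H), ROW (1) child (ρ1a) — THE TYPE-(1) H-SIDE DICTIONARY IN AFFINE FORM: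
# near `1 ∈ H_v` (in fact EVERYWHERE), for a `G`-regular `γ_H` with distinct norm-one `w`-roots `α ≠ γ` of depth `N ≥ depthOfRecord d`, `N + d` even,
# `Φ^st(γ_H, hFamily s) = 2ν_s · 2(q^{(N−d)∕2+1} − 1)∕(q − 1) + (if s = d mod 2 then 0 else −2ν_s)`

Cell `hodgecm-mathlib` (D-0151), FLOOR 0, crux item H413 = `stmt-HodgeConjecture-24833`, route of record `HCCMUnconditional`; squad F0∕P3c∕LH4 (req620).  THEOREMS ONLY (no `def`,
no instance, no notation, no named fact, no `sorry`, default heartbeats); lane `--supports stmt-HodgeConjecture-24833 --as helper` (count-neutral).  HEAD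
**`hProfiles_typeOne_affine_wild`** = the statement of the registered child (ρ1a) `stub_U2H_hProfiles_typeOne_affine_wild` (U2H ED. 10, LH4-p06 (g2) text e191b44861c9f7e9 =
★ p855670's binder `hΦ` at `κ* s = 2ν_s`, `lam* s = [s ≠ d mod 2]·(−2ν_s)`, `n* N = (N − d)∕2`) TOKEN FOR TOKEN, typed under the Lines module's scopes; it is consumed BY NAME by
★ p855881 `F0P3cDyRamRowOneAtCoefStar.rowOne_coefStar_of_hProfiles_affine` (ROW (1) of (ρ) at coef*).

THE ASSEMBLY (LH4-p12 (g0) HANDOFF §OPEN, steps 1–11; every mathematical input is ★).  Fix `γ_H ∈ H_v = U₂ × U₁` `G`-regular with distinct norm-one roots `α ≠ γ ∈ L_w` of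
`χ(γ₂)_w`, `|α − γ|_w = |ϖ|^N`.  (1) ELLIPTIC: ★ p855564.  (2) an anti-fixed `α₀ ∈ L_w^×`, a unit or a uniformiser (★ `RamifiedPlaceAntiFixedDichotomy`); §1 here: it is a unit
iff `d` is EVEN (`α₀·(ϖ − σϖ)` is `σ`-fixed, so its valuation `|α₀|·|ϖ|^d` is an even power — datum clause 4).  (3) DESCENT `diag(1,α₀)·E₂γ₂·diag(1,α₀)⁻¹ = s·ι(g)` (★ (W1)).
(4) the Eisenstein datum `(u₀, v₀)` of the record's `ϖ` (★ `exists_eisenstein_coeffs_of_ramified'`).  (4a)(4b) ★ p855933: `tr²g − 4det g = (u₀² + 4v₀)z²`, `z ≠ 0`, and the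
deepness bound from `N ≥ d`.  (5) the torus-form package ★ p855714: `h g h⁻¹ = c·(1, bv₀; b, 1 + bu₀)`, `b ∈ 𝒪_v`, `b(t − zu₀) = 2z` (so `b ≠ 0`).  (4c) ★ p855833: the roots are
`s·ιc·(1 + ιb·ϖ)`, `s·ιc·(1 + ιb·σϖ)` and `|b|_v = |ϖ_v|^{(N − d)∕2}`.  (4e) the root vertex `latt 1` is special.  (6) ★ p855773 (four heads: profile `s` × place type of `α₀`):
`Φ^st(γ_H, hFamily s) = ν_H(K_s × U₁)·2N′` with `(q_v − 1)N′ + 2 = 2q_v^{n+1}` on the VERTEX column (`s = 0` at √u, `s = 1` at √π) and `(q_v − 1)(N′ + 1) + 2 = 2q_v^{n+1}` on the EDGE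
column — by §1 the vertex column is `s = d mod 2`.  (4d) `q_v = #𝓀(𝒪[L⁺_v]) = #𝓀_w` (★ + ★, `f(w|v) = 1`) and `supp hFamily s = K_s × U₁` (★ `hProfileZero_eq_indicator_prod_top`, ★
`forall_v_sharp_iff_coe_mem_map_conj`).  (4f) §2 arithmetic: `N′ = V := 2(q^{n+1} − 1)∕(q − 1)` resp. `V − 1`, i.e. `ν·2N′ = 2ν·V + 0` resp. `2ν·V − 2ν`.  The witness
neighbourhood is `univ`.

* §1 `mod_two_eq_zero_of_antiFixed_of_v_eq_one`, `mod_two_eq_one_of_antiFixed_of_v_eq_exp_neg_one` (place type ↔ parity of `d`).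
* §2 `mul_two_mul_eq_affine_of_vertex_law`, `mul_two_mul_eq_affine_of_edge_law` (the ℕ-laws in affine `ℚ → ℂ` currency).
* §3 `natCard_residueField_integer_eq_card_valuedResidueField` ((4d)), `support_hFamily_zero_eq_coe_prod_top`, `support_hFamily_one_eq_coe_prod_top`.
* §4 HEAD `hProfiles_typeOne_affine_wild`.

HONEST LABEL.  Count-neutral; nothing printed is asserted; `HC_CM` is proved only modulo the 7 printed citations (2 remaining named inputs: hLiu418 = `stmt-HodgeConjecture-24832`,
h413 = `stmt-HodgeConjecture-24833`) until rung 0 closes.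

## References
* [Rogawski1990] J. D. Rogawski, *Automorphic Representations of Unitary Groups in Three Variables*, Ann. of Math. Stud. 123 (1990): §4.9 Prop. 4.9.1 (b) p. 55, Lemma 4.9.3
  p. 56 (the `H`-side of the unit transfer by root depth); §3.6 pp. 28–29 (type (1), `U(1,1)`).
* [LabesseLanglands1979] J.-P. Labesse, R. P. Langlands, *L-indistinguishability for SL(2)*, Canad. J. Math. 31 (1979), §2 pp. 7–8 (Eisenstein tori, fixed balls, `δ_m = 2q^m`).
* [Kottwitz1988] R. E. Kottwitz, *Tamagawa numbers*, Ann. of Math. 127 (1988), §2 (orbital integrals of indicators as fixed-coset counts).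
* [Serre1979] J.-P. Serre, *Local Fields*, GTM 67 (1979), Ch. I §6 Prop. 18 (Eisenstein equations), Ch. II §2, Ch. IV §§1–2 (ramification, the different).
* [Jacobowitz1962] R. Jacobowitz, *Hermitian forms over local fields*, Amer. J. Math. 84 (1962), §5, §9 (ramified dyadic: R-U ∕ R-P, parity of the different exponent).
-/

set_option autoImplicit false

noncomputable section

namespace Summit.HodgeConjecture.HodgeConjecture.Cruxes.H413.F0P3cDyRamHProfilesTypeOneAffineWild

open MeasureTheory Measure NumberField IsDedekindDomain Topology Filter MulAction Matrix WithZero ValuativeRel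
open Literature.NumberTheory.Automorphic Literature.NumberTheory.Automorphic.UnitaryGroup Literature.NumberTheory.Automorphic.IntegralReduction
open Literature.NumberTheory.Rogawski1990 Literature.NumberTheory.GaloisRepresentations
open Literature.NumberTheory.Automorphic.UnitaryThreeFourFrame
open Literature.NumberTheory.Automorphic.HermitianLatticeTree
open Literature.NumberTheory.Automorphic.UnitaryLatticeTree Literature.NumberTheory.Automorphic.HermitianLattice
open Summit.HodgeConjecture.HodgeConjecture.Cruxes.H413.F0P3cDyRamFourFrameHSideDefs
open Summit.HodgeConjecture.HodgeConjecture.Cruxes.H413.F0P3cDyRamFourFrameHFamilyDefs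
open Summit.HodgeConjecture.HodgeConjecture.Cruxes.H413.F0P3cDyRamHProfilesTypeTwoUnfolding (hFamily_zero hFamily_one hProfileZero_eq_indicator_prod_top)
open Summit.HodgeConjecture.HodgeConjecture.Cruxes.H413.F0P3cDyRamHSideTypeOneTorusForm
open Summit.HodgeConjecture.HodgeConjecture.Cruxes.H413.F0P3cDyRamTypeOneTorusConductor
open scoped Matrix MatrixGroups Classical ValuativeRel WithZero

/-! ## §1 Place type ↔ parity of `d`: an anti-fixed element is a unit iff `d` is even -/

section Parity

variable {K : Type} [Field K] [Valued K ℤᵐ⁰] {σ : K →+* K} {ϖ : K} {d t : ℕ}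

/-- For the datum of record `(σ, ϖ, d, t)` and an anti-fixed `a` (`σ a = −a`), the product `a·(ϖ − σϖ)` is `σ`-FIXED and non-zero (when `a ≠ 0`), so `|a|·|ϖ|^d = exp(2n)` for some
`n ∈ ℤ` (datum clause 4: fixed elements have even valuation). [cite: Jacobowitz1962, §5] [cite: Serre1979, Ch. IV §§1–2] -/
theorem exists_v_mul_pow_eq_exp_two_mul_of_antiFixed (hD : IsRamifiedQuadraticDatum σ ϖ d t) {a : K} (ha : σ a = -a) (ha0 : a ≠ 0) :
    ∃ n : ℤ, Valued.v a * Valued.v ϖ ^ d = WithZero.exp (2 * n) := by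
  obtain ⟨hσσ, -, hϖ, hfix, hd, -, -⟩ := hD
  have hδ0 : ϖ - σ ϖ ≠ 0 := by
    intro h0
    have h := hd
    rw [h0, map_zero, hϖ, ← WithZero.exp_nsmul] at h
    exact WithZero.zero_ne_coe h
  have hxfix : σ (a * (ϖ - σ ϖ)) = a * (ϖ - σ ϖ) := by
    rw [map_mul, map_sub, ha, hσσ]; ring
  obtain ⟨n, hn⟩ := hfix _ hxfix (mul_ne_zero ha0 hδ0)
  exact ⟨n, by rw [← hd, ← map_mul, hn]⟩

/-- **√u-TYPE ⇒ `d` EVEN**: if an anti-fixed UNIT exists (`σ a = −a`, `|a| = 1`) then `d % 2 = 0`. [cite: Jacobowitz1962, §5, §9] [cite: Serre1979, Ch. IV §§1–2] -/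
theorem mod_two_eq_zero_of_antiFixed_of_v_eq_one (hD : IsRamifiedQuadraticDatum σ ϖ d t) {a : K} (ha : σ a = -a) (hva : Valued.v a = 1) : d % 2 = 0 := by
  have ha0 : a ≠ 0 := fun h => by rw [h, map_zero] at hva; exact zero_ne_one hva
  have hϖ := hD.2.2.1
  obtain ⟨n, hn⟩ := exists_v_mul_pow_eq_exp_two_mul_of_antiFixed hD ha ha0
  rw [hva, one_mul, hϖ, ← WithZero.exp_nsmul, nsmul_eq_mul, WithZero.exp_inj] at hn
  omega

/-- **√π-TYPE ⇒ `d` ODD**: if an anti-fixed UNIFORMISER exists (`σ a = −a`, `|a| = exp(−1)`) then `d % 2 = 1`. [cite: Jacobowitz1962, §5, §9] [cite: Serre1979, Ch. IV §§1–2] -/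
theorem mod_two_eq_one_of_antiFixed_of_v_eq_exp_neg_one (hD : IsRamifiedQuadraticDatum σ ϖ d t) {a : K} (ha : σ a = -a) (hva : Valued.v a = WithZero.exp (-1 : ℤ)) :
    d % 2 = 1 := by
  have ha0 : a ≠ 0 := fun h => by rw [h, map_zero] at hva; exact WithZero.zero_ne_coe hva
  have hϖ := hD.2.2.1
  obtain ⟨n, hn⟩ := exists_v_mul_pow_eq_exp_two_mul_of_antiFixed hD ha ha0
  rw [hva, hϖ, ← WithZero.exp_nsmul, nsmul_eq_mul, ← WithZero.exp_add, WithZero.exp_inj] at hn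
  omega

end Parity

/-! ## §2 The two ℕ-laws in affine `ℚ → ℂ` currency -/

/-- **VERTEX COLUMN**: `(q − 1)·N′ + 2 = 2·q^{n+1}` (`2 ≤ q`) gives `ν·(2N′) = 2ν·↑(2(q^{n+1} − 1)∕(q − 1)) + 0`. [cite: LabesseLanglands1979, §2 p. 8] [cite: Rogawski1990, §4.9 Prop. 4.9.1 (b) p. 55] -/
theorem mul_two_mul_eq_affine_of_vertex_law {q N' n : ℕ} (hq : 2 ≤ q) (h : (q - 1) * N' + 2 = 2 * q ^ (n + 1)) (ν : ℂ) :
    ν * (2 * (N' : ℂ)) = 2 * ν * (((2 * ((q : ℚ) ^ (n + 1) - 1) / ((q : ℚ) - 1) : ℚ)) : ℂ) + 0 := by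
  have hq1 : 1 ≤ q := le_trans (by norm_num) hq
  have hqQ : ((q : ℚ) - 1) ≠ 0 := by
    have : (2 : ℚ) ≤ q := by exact_mod_cast hq
    linarith
  have h' := congrArg (fun m : ℕ => (m : ℚ)) h
  simp only [Nat.cast_add, Nat.cast_mul, Nat.cast_sub hq1, Nat.cast_one, Nat.cast_ofNat, Nat.cast_pow] at h'
  have hN : (N' : ℚ) = 2 * ((q : ℚ) ^ (n + 1) - 1) / ((q : ℚ) - 1) := by
    rw [eq_div_iff hqQ]; linarith
  rw [add_zero, show (N' : ℂ) = ((N' : ℚ) : ℂ) by norm_cast, hN]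
  ring

/-- **EDGE COLUMN**: `(q − 1)·(N′ + 1) + 2 = 2·q^{n+1}` (`2 ≤ q`) gives `ν·(2N′) = 2ν·↑(2(q^{n+1} − 1)∕(q − 1)) + (−2ν)` (one fewer edge than vertices on the fixed subtree).
[cite: LabesseLanglands1979, §2 p. 8] [cite: Rogawski1990, §4.9 Prop. 4.9.1 (b) p. 55] -/
theorem mul_two_mul_eq_affine_of_edge_law {q N' n : ℕ} (hq : 2 ≤ q) (h : (q - 1) * (N' + 1) + 2 = 2 * q ^ (n + 1)) (ν : ℂ) :
    ν * (2 * (N' : ℂ)) = 2 * ν * (((2 * ((q : ℚ) ^ (n + 1) - 1) / ((q : ℚ) - 1) : ℚ)) : ℂ) + -2 * ν := by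
  have hq1 : 1 ≤ q := le_trans (by norm_num) hq
  have hqQ : ((q : ℚ) - 1) ≠ 0 := by
    have : (2 : ℚ) ≤ q := by exact_mod_cast hq
    linarith
  have h' := congrArg (fun m : ℕ => (m : ℚ)) h
  simp only [Nat.cast_add, Nat.cast_mul, Nat.cast_sub hq1, Nat.cast_one, Nat.cast_ofNat, Nat.cast_pow] at h'
  have hN : (N' : ℚ) = 2 * ((q : ℚ) ^ (n + 1) - 1) / ((q : ℚ) - 1) - 1 := by
    rw [eq_sub_iff_add_eq, eq_div_iff hqQ]; linarith
  rw [show (N' : ℂ) = ((N' : ℚ) : ℂ) by norm_cast, hN]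
  push_cast
  ring

/-! ## §3 At the CM place: the residue cardinalities and the supports of the two profiles -/

section Place

variable (L : Type) [Field L] [NumberField L] [IsCMField L] {v : HeightOneSpectrum (𝓞 ↥(maximalRealSubfield L))}
  (w : PlacesOver L v) (hw : IsCMField.complexConj L • w.1 = w.1)

include hw in
/-- **(4d) `#𝓀(𝒪[L⁺_v]) = #𝓀_w`** at a ramified place (`ValuativeRel` valuation ring of `L⁺_v` on the left, Mathlib's `Valued.ResidueField L_w` on the right): both are `#(𝓞_{L⁺} ∕ v)`
(★ `natCard_valuativeResidueField_adicCompletion_eq`, ★ `natCard_valuedResidueField_eq_of_ramified_CM`: `f(w|v) = 1`). [cite: Serre1979, Ch. II §2] -/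
theorem natCard_residueField_integer_eq_card_valuedResidueField (he : v.asIdeal.ramificationIdx' w.1.asIdeal ≠ 1)
    [Fintype (Valued.ResidueField (w.1.adicCompletion L))] :
    Nat.card (IsLocalRing.ResidueField 𝒪[v.adicCompletion ↥(maximalRealSubfield L)]) = Fintype.card (Valued.ResidueField (w.1.adicCompletion L)) := by
  rw [natCard_valuativeResidueField_adicCompletion_eq, ← Nat.card_eq_fintype_card, HeightOneSpectrum.residueCard_eq_card_quotient]
  exact (natCard_valuedResidueField_eq_of_ramified_CM L v w hw he).symm

include hw in
/-- `supp (hFamily … 0) = K₂ × U₁` as a set (`K₁ = U₁`: ★ `hProfileZero_eq_indicator_prod_top`). [cite: Rogawski1990, §4.9 Lemma 4.9.3 p. 56] -/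
theorem support_hFamily_zero_eq_coe_prod_top (ϖ : w.1.adicCompletion L) :
    Function.support (hFamily L w hw ϖ 0) =
      ((((cmLocalIntegralLevel L 2 (Matrix.of fun i j : Fin 2 => if i.val + j.val + 1 = 2 then (1 : L) else 0) v).prod
          (⊤ : Subgroup ((cmDatum L 1 (Matrix.of fun i j : Fin 1 => if i.val + j.val + 1 = 1 then (1 : L) else 0)).Local v))) :
          Subgroup ((cmDatum L 2 (Matrix.of fun i j : Fin 2 => if i.val + j.val + 1 = 2 then (1 : L) else 0)).Local v ×
            (cmDatum L 1 (Matrix.of fun i j : Fin 1 => if i.val + j.val + 1 = 1 then (1 : L) else 0)).Local v)) :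
        Set ((cmDatum L 2 (Matrix.of fun i j : Fin 2 => if i.val + j.val + 1 = 2 then (1 : L) else 0)).Local v ×
          (cmDatum L 1 (Matrix.of fun i j : Fin 1 => if i.val + j.val + 1 = 1 then (1 : L) else 0)).Local v)) := by
  rw [hFamily_zero, hProfileZero_eq_indicator_prod_top L w hw, Set.support_indicator, Function.support_const one_ne_zero, Set.inter_univ]

include hw in
/-- `supp (hFamily … 1) = K♯ × U₁` as a set, for any `K♯ ≤ U₂` matched with `D_ϖ GL₂(𝒪_w) D_ϖ⁻¹` (the `χ♯` set-builder of `hProfileSharp` IS that membership: ★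
`forall_v_sharp_iff_coe_mem_map_conj`). [cite: Rogawski1990, §4.9 Lemma 4.9.3 p. 56] [cite: LabesseLanglands1979, §2 pp. 8–10] -/
theorem support_hFamily_one_eq_coe_prod_top (ϖ : (w.1.adicCompletion L)ˣ)
    (Ksh : Subgroup ((cmDatum L 2 (Matrix.of fun i j : Fin 2 => if i.val + j.val + 1 = 2 then (1 : L) else 0)).Local v))
    (hKsh : ∀ g, g ∈ Ksh ↔
        (((localNonsplitEquiv (IsCMField.complexConj L) (Matrix.of fun i j : Fin 2 => if i.val + j.val + 1 = 2 then (1 : L) else 0) (IsCMField.complexConj_ne_one L) w hw) g : ↥(unitaryGroupOfForm (galAdicCompletionMap (L := L) (IsCMField.complexConj L) hw) (placeForm (Matrix.of fun i j : Fin 2 => if i.val + j.val + 1 = 2 then (1 : L) else 0) w.1))) : GL (Fin 2) (w.1.adicCompletion L)) ∈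
          (glInt 2 (w.1.adicCompletion L)).map (MulAut.conj (glDiagonal 2 (w.1.adicCompletion L) ![1, ϖ])).toMonoidHom) :
    Function.support (hFamily L w hw (ϖ : w.1.adicCompletion L) 1) =
      (((Ksh.prod (⊤ : Subgroup ((cmDatum L 1 (Matrix.of fun i j : Fin 1 => if i.val + j.val + 1 = 1 then (1 : L) else 0)).Local v))) :
          Subgroup ((cmDatum L 2 (Matrix.of fun i j : Fin 2 => if i.val + j.val + 1 = 2 then (1 : L) else 0)).Local v ×
            (cmDatum L 1 (Matrix.of fun i j : Fin 1 => if i.val + j.val + 1 = 1 then (1 : L) else 0)).Local v)) :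
        Set ((cmDatum L 2 (Matrix.of fun i j : Fin 2 => if i.val + j.val + 1 = 2 then (1 : L) else 0)).Local v ×
          (cmDatum L 1 (Matrix.of fun i j : Fin 1 => if i.val + j.val + 1 = 1 then (1 : L) else 0)).Local v)) := by
  rw [hFamily_one]
  unfold hProfileSharp
  rw [Set.support_indicator, Function.support_const one_ne_zero, Set.inter_univ]
  ext h
  rw [Set.mem_setOf_eq, SetLike.mem_coe, Subgroup.mem_prod, hKsh h.1, forall_v_sharp_iff_coe_mem_map_conj L w hw ϖ]
  simp only [Subgroup.mem_top, and_true]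

end Place

/-! ## §4 HEAD — the (ρ1a) text, token for token -/

/-- **(ρ1a) THE TYPE-(1) H-SIDE DICTIONARY IN AFFINE FORM** — the statement of the registered child `stub_U2H_hProfiles_typeOne_affine_wild` (U2H ED. 10) token for token
(= ★ p855670's binder `hΦ` at `κ* s = 2ν_s`, `lam* s = [s ≠ d mod 2]·(−2ν_s)`, `n* N = (N − d)∕2`): at a wild ramified non-split CM place `w ∣ v` with datum of record
`(σ_w, ϖ, d, t_E)`, for EVERY (witness neighbourhood `univ`) `G`-regular `γ_H ∈ H_v` whose `w`-characteristic polynomial has distinct NORM-ONE roots `α ≠ γ` with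
`|α − γ|_w = exp(−N)`, `depthOfRecord d ≤ N`, `N + d` even, and each profile `s`:
`Φ^st(γ_H, hFamily s) = 2·ν_H(supp hFamily s)·(2(q^{(N−d)∕2+1} − 1)∕(q − 1)) + (if s = d mod 2 then 0 else −2·ν_H(supp hFamily s))`, `q = #𝓀_w`.
Assembly of ★ p855564 (elliptic) · ★ anti-fixed dichotomy + §1 (place type = parity of `d`) · ★ (W1) descent · ★ Eisenstein datum · ★ p855933 (4a)(4b) · ★ p855714 (torus form) ·
★ p855833 (4c) conductor `n = (N − d)∕2` · ★ p855773 (the four torus-form heads) · §3 (4d) + supports · §2 (4f).  The hypotheses `_h2`, `tE` are not used (the dictionary holds at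
every ramified place). [cite: Rogawski1990, §4.9 Prop. 4.9.1 (b) p. 55, Lemma 4.9.3 p. 56; §3.6 pp. 28–29] [cite: LabesseLanglands1979, §2 pp. 7–8] [cite: Kottwitz1988, §2] [cite: Serre1979, Ch. I §6 Prop. 18; Ch. IV §§1–2] -/
theorem hProfiles_typeOne_affine_wild :
    ∀ (L : Type) [Field L] [NumberField L] [IsCMField L]
      {v : HeightOneSpectrum (𝓞 ↥(maximalRealSubfield L))} (w : UnitaryGroup.PlacesOver L v)
      (hw : IsCMField.complexConj L • w.1 = w.1) (_he : v.asIdeal.ramificationIdx' w.1.asIdeal ≠ 1)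
      (_h2 : ¬ IsUnit (2 : 𝒪[w.1.adicCompletion L]))
      (ϖ : (w.1.adicCompletion L)) (_hϖ : Valued.v ϖ = WithZero.exp (-1 : ℤ)) (d tE : ℕ) (_hD : IsRamifiedQuadraticDatum (galAdicCompletionMap (L := L) (IsCMField.complexConj L) hw) ϖ d tE)
      [Fintype (Valued.ResidueField (w.1.adicCompletion L))]
      [MeasurableSpace ((UnitaryGroup.cmDatum L 2 (Matrix.of fun i j : Fin 2 => if i.val + j.val + 1 = 2 then (1 : L) else 0)).Local v × (UnitaryGroup.cmDatum L 1 (Matrix.of fun i j : Fin 1 => if i.val + j.val + 1 = 1 then (1 : L) else 0)).Local v)] [BorelSpace ((UnitaryGroup.cmDatum L 2 (Matrix.of fun i j : Fin 2 => if i.val + j.val + 1 = 2 then (1 : L) else 0)).Local v × (UnitaryGroup.cmDatum L 1 (Matrix.of fun i j : Fin 1 => if i.val + j.val + 1 = 1 then (1 : L) else 0)).Local v)]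
      [∀ a : ((UnitaryGroup.cmDatum L 2 (Matrix.of fun i j : Fin 2 => if i.val + j.val + 1 = 2 then (1 : L) else 0)).Local v × (UnitaryGroup.cmDatum L 1 (Matrix.of fun i j : Fin 1 => if i.val + j.val + 1 = 1 then (1 : L) else 0)).Local v), MeasurableSpace (((UnitaryGroup.cmDatum L 2 (Matrix.of fun i j : Fin 2 => if i.val + j.val + 1 = 2 then (1 : L) else 0)).Local v × (UnitaryGroup.cmDatum L 1 (Matrix.of fun i j : Fin 1 => if i.val + j.val + 1 = 1 then (1 : L) else 0)).Local v) ⧸ Subgroup.centralizer ({a} : Set ((UnitaryGroup.cmDatum L 2 (Matrix.of fun i j : Fin 2 => if i.val + j.val + 1 = 2 then (1 : L) else 0)).Local v × (UnitaryGroup.cmDatum L 1 (Matrix.of fun i j : Fin 1 => if i.val + j.val + 1 = 1 then (1 : L) else 0)).Local v)))]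
      [∀ a : ((UnitaryGroup.cmDatum L 2 (Matrix.of fun i j : Fin 2 => if i.val + j.val + 1 = 2 then (1 : L) else 0)).Local v × (UnitaryGroup.cmDatum L 1 (Matrix.of fun i j : Fin 1 => if i.val + j.val + 1 = 1 then (1 : L) else 0)).Local v), BorelSpace (((UnitaryGroup.cmDatum L 2 (Matrix.of fun i j : Fin 2 => if i.val + j.val + 1 = 2 then (1 : L) else 0)).Local v × (UnitaryGroup.cmDatum L 1 (Matrix.of fun i j : Fin 1 => if i.val + j.val + 1 = 1 then (1 : L) else 0)).Local v) ⧸ Subgroup.centralizer ({a} : Set ((UnitaryGroup.cmDatum L 2 (Matrix.of fun i j : Fin 2 => if i.val + j.val + 1 = 2 then (1 : L) else 0)).Local v × (UnitaryGroup.cmDatum L 1 (Matrix.of fun i j : Fin 1 => if i.val + j.val + 1 = 1 then (1 : L) else 0)).Local v)))]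
      (νH : Measure ((UnitaryGroup.cmDatum L 2 (Matrix.of fun i j : Fin 2 => if i.val + j.val + 1 = 2 then (1 : L) else 0)).Local v × (UnitaryGroup.cmDatum L 1 (Matrix.of fun i j : Fin 1 => if i.val + j.val + 1 = 1 then (1 : L) else 0)).Local v)) [νH.IsHaarMeasure] [νH.IsMulRightInvariant]
      (mH : OrbitalMeasureFamily ((UnitaryGroup.cmDatum L 2 (Matrix.of fun i j : Fin 2 => if i.val + j.val + 1 = 2 then (1 : L) else 0)).Local v × (UnitaryGroup.cmDatum L 1 (Matrix.of fun i j : Fin 1 => if i.val + j.val + 1 = 1 then (1 : L) else 0)).Local v))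
      (_hmH : mH.IsCanonical (IsLocalGRegular L v) νH),
      ∃ V ∈ 𝓝 (1 : ((UnitaryGroup.cmDatum L 2 (Matrix.of fun i j : Fin 2 => if i.val + j.val + 1 = 2 then (1 : L) else 0)).Local v × (UnitaryGroup.cmDatum L 1 (Matrix.of fun i j : Fin 1 => if i.val + j.val + 1 = 1 then (1 : L) else 0)).Local v)), ∀ γH ∈ V, IsLocalGRegular L v γH →
              ∀ (α γ : (w.1.adicCompletion L)), ((((γH).1.val : GL (Fin 2) (UnitaryGroup.LocalRing L v)).val.map (Pi.evalRingHom (fun w' : UnitaryGroup.PlacesOver L v => w'.1.adicCompletion L) w))).charpoly.IsRoot α → ((((γH).1.val : GL (Fin 2) (UnitaryGroup.LocalRing L v)).val.map (Pi.evalRingHom (fun w' : UnitaryGroup.PlacesOver L v => w'.1.adicCompletion L) w))).charpoly.IsRoot γ → α ≠ γ → α * (galAdicCompletionMap (L := L) (IsCMField.complexConj L) hw) α = 1 → γ * (galAdicCompletionMap (L := L) (IsCMField.complexConj L) hw) γ = 1 →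
                ∀ N : ℕ, Valued.v (α - γ) = WithZero.exp (-(N : ℤ)) → depthOfRecord d ≤ N → (N + d) % 2 = 0 →
                  ∀ s : Fin 2, stableOrbitalIntegralRel (IsLocalStablyConjH L v) mH (hFamily L w hw ϖ s) γH =
                    (2 * (νH.real (Function.support (hFamily L w hw ϖ s)) : ℂ)) * (((2 * ((Fintype.card (Valued.ResidueField (w.1.adicCompletion L)) : ℚ) ^ (((N - d) / 2 : ℕ) + 1) - 1) / ((Fintype.card (Valued.ResidueField (w.1.adicCompletion L)) : ℚ) - 1) : ℚ)) : ℂ) + (if ((s : Fin 2) : ℕ) = d % 2 then (0 : ℂ) else -2 * (νH.real (Function.support (hFamily L w hw ϖ s)) : ℂ)) := by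
  intro L _ _ _ v w hw he _h2 ϖ hϖ d tE hD _ _ _ _ _ νH _ _ mH hmH
  refine ⟨Set.univ, Filter.univ_mem, ?_⟩
  intro γH _ hreg α γ hα hγ hαγ hα1 hγ1 N hN hN₀ hpar s
  -- `ϖ ≠ 0`; make it a unit (the `s = 1` heads of ★ p855773 are keyed on `ϖ : L_wˣ`)
  have hϖ0 : ϖ ≠ 0 := fun h0 => by rw [h0, map_zero] at hϖ; exact WithZero.zero_ne_coe hϖ
  obtain ⟨ϖu, rfl⟩ : ∃ ϖu : (w.1.adicCompletion L)ˣ, (ϖu : w.1.adicCompletion L) = ϖ := ⟨Units.mk0 ϖ hϖ0, rfl⟩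
  -- the F-side uniformiser, the finiteness of `𝓀(𝒪[L⁺_v])`, the residue cardinalities ((4d))
  have hϖF : Valued.v (HeckeCharacter.uniformizer ↥(maximalRealSubfield L) v : v.adicCompletion ↥(maximalRealSubfield L)) = WithZero.exp (-1 : ℤ) :=
    HeckeCharacter.valued_uniformizer v
  haveI : Finite (IsLocalRing.ResidueField 𝒪[v.adicCompletion ↥(maximalRealSubfield L)]) := by
    refine Nat.finite_of_card_ne_zero ?_
    rw [natCard_valuativeResidueField_adicCompletion_eq]
    have h1 := v.one_lt_residueCard
    omega
  have hqq := natCard_residueField_integer_eq_card_valuedResidueField L w hw he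
  have hq2 : 2 ≤ Nat.card (IsLocalRing.ResidueField 𝒪[v.adicCompletion ↥(maximalRealSubfield L)]) := by
    rw [hqq]; exact Fintype.one_lt_card
  -- (2) an anti-fixed unit or uniformiser `α₀`
  obtain ⟨α₀, hα₀, hvα₀⟩ := exists_units_galAdicCompletionMap_complexConj_eq_neg_of_ramified L w hw he
  have hα₀0 : (α₀ : w.1.adicCompletion L) ≠ 0 := α₀.ne_zero
  -- (3) the one-place model `U = E₂ γ₂` and its descent `diag(1,α₀) U diag(1,α₀)⁻¹ = s·ι(g)`
  set U := (localNonsplitEquiv (IsCMField.complexConj L) (Matrix.of fun i j : Fin 2 => if i.val + j.val + 1 = 2 then (1 : L) else 0) (IsCMField.complexConj_ne_one L) w hw) γH.1 with hUdef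
  obtain ⟨s₀, g, hs, hsg⟩ := descent_of_mem_unitaryGroupOfForm_antidiag L v w hw hα₀ hα₀0 _ (coe_mem_unitaryGroupOfForm_antidiag_two_of_mem_placeForm L w hw U)
  -- the root letters in one-place tokens (★ `coe_localNonsplitEquiv_eq_map`, definitional)
  have hαU : (((U : GL (Fin 2) (w.1.adicCompletion L)) : Matrix (Fin 2) (Fin 2) (w.1.adicCompletion L))).charpoly.IsRoot α := hα
  have hγU : (((U : GL (Fin 2) (w.1.adicCompletion L)) : Matrix (Fin 2) (Fin 2) (w.1.adicCompletion L))).charpoly.IsRoot γ := hγ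
  -- (1) type (1): split at `w` and elliptic (★ p855564)
  have hsplit : ∃ x : (w.1.adicCompletion L), ((((γH.1.val : GL (Fin 2) (UnitaryGroup.LocalRing L v)).val.map (Pi.evalRingHom (fun w' : PlacesOver L v => w'.1.adicCompletion L) w))).charpoly).IsRoot x := ⟨α, hα⟩
  have hell := not_exists_conj_glDiagonal_of_isRoot_of_norm_one L v w hw hα hγ hαγ hα1
  -- (4) the Eisenstein datum of `ϖ`
  obtain ⟨u₀, v₀, -, htr, hnm, hu, hu1, hv1⟩ := exists_eisenstein_coeffs_of_ramified' L v w hw he hϖF hϖ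
  -- (4a) the descended discriminant, (4b) the deepness bound from `N ≥ d`
  obtain ⟨z, hz0, hDz, -⟩ := exists_disc_eq_eisenstein_mul_sq_of_typeOne L v w hw he hα₀ hα₀0 U.2 hs hsg hαU hγU hαγ hα1 hγ1 hϖ htr hnm
  have hd : Valued.v ((ϖu : w.1.adicCompletion L) - galAdicCompletionMap (L := L) (IsCMField.complexConj L) hw ϖu) = Valued.v (ϖu : w.1.adicCompletion L) ^ d := hD.2.2.2.2.1
  have hdN : d ≤ N := by
    unfold depthOfRecord at hN₀
    split_ifs at hN₀ <;> omega
  have hdeep' := valuation_disc_le_of_typeOne_of_depth L v w hw he hα₀0 hs hsg hαU hγU hαγ hα1 hγ1 hϖ htr hnm hd hN hdN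
  have hdisc := eisenstein_disc_ne_zero L v w hw he hϖ htr hnm
  -- (5) the torus-form package ★ p855714
  have hϖFu : IsUniformizingElement (HeckeCharacter.uniformizer ↥(maximalRealSubfield L) v : v.adicCompletion ↥(maximalRealSubfield L)) := isUniformizingElement_of_v_eq hϖF
  obtain ⟨γ₁, h, c, b, hc, hconj, hγ₁, hb, hγ₁det, hbt⟩ :=
    exists_torusForm_binders_of_eisenstein_of_deep' (two_ne_zero) hϖFu (g := g) rfl rfl hz0 hdisc hDz hu1 hv1 hdeep'
  have hb0 : b ≠ 0 := by
    intro h0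
    rw [h0, zero_mul] at hbt
    exact mul_ne_zero two_ne_zero hz0 hbt.symm
  -- (4c) the conductor `|b|_v = |ϖ_v|^{(N − d)∕2}` (★ p855833, either orientation of the root pair)
  have htrU := trace_eq_smul_of_descent (toPlace v w) hα₀0 hsg
  have hdetU := det_eq_smul_of_descent (toPlace v w) hα₀0 hsg
  have hτ : toPlace v w u₀ = (ϖu : w.1.adicCompletion L) + galAdicCompletionMap (L := L) (IsCMField.complexConj L) hw ϖu := htr.symm
  have hττ' : toPlace v w v₀ = -((ϖu : w.1.adicCompletion L) * galAdicCompletionMap (L := L) (IsCMField.complexConj L) hw ϖu) := by rw [hnm, neg_neg]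
  have hN' : Valued.v (α - γ) = Valued.v (ϖu : w.1.adicCompletion L) ^ N := by
    rw [hN, hϖ, ← WithZero.exp_nsmul, nsmul_eq_mul, mul_neg, mul_one]
  have hbn : valuation (v.adicCompletion ↥(maximalRealSubfield L)) b =
      valuation (v.adicCompletion ↥(maximalRealSubfield L)) (HeckeCharacter.uniformizer ↥(maximalRealSubfield L) v : v.adicCompletion ↥(maximalRealSubfield L)) ^ ((N - d) / 2) := by
    rcases ratio_of_isRoot_of_isRoot (toPlace v w) htrU hdetU hconj hγ₁ hτ hττ' hαU hγU hαγ with hr | hr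
    · exact (valuation_eq_pow_half_of_depth L v w hw he hD hϖF hb0 hb (valued_eq_one_of_mul_galAdicCompletionMap_eq_one L v w hw hγ1) hr hN').2.1
    · have hN'' : Valued.v (γ - α) = Valued.v (ϖu : w.1.adicCompletion L) ^ N := by rw [← neg_sub, Valuation.map_neg, hN']
      exact (valuation_eq_pow_half_of_depth L v w hw he hD hϖF hb0 hb (valued_eq_one_of_mul_galAdicCompletionMap_eq_one L v w hw hα1) hr hN'').2.1
  -- (4e) the root vertex `latt 1` of the tree of `SL₂(L⁺_v)` is special
  have hx₀S : IsSpecialLattice (RingHom.id (v.adicCompletion ↥(maximalRealSubfield L))) (HeckeCharacter.uniformizer ↥(maximalRealSubfield L) v : v.adicCompletion ↥(maximalRealSubfield L))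
      !![(0 : v.adicCompletion ↥(maximalRealSubfield L)), 1; -1, 0] (latt (1 : Matrix (Fin 2) (Fin 2) (v.adicCompletion ↥(maximalRealSubfield L)))) := by
    have h1 := isSpecialLattice_latt_of_valuation_det hϖFu.ne_zero (1 : GL (Fin 2) (v.adicCompletion ↥(maximalRealSubfield L))) (e := 0) (Or.inl rfl)
      (by rw [Units.val_one, Matrix.det_one, zpow_zero])
    rwa [Units.val_one] at h1
  -- the `s = 1` level `K♯` (★ `exists_vertexCover_of_ramified_wild`) and the two supports
  obtain ⟨K₂, -, -, hK1mem, hKo, hKc, -⟩ := exists_vertexCover_of_ramified_wild L v w hw he ϖu hϖ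
  have hsupp0 := support_hFamily_zero_eq_coe_prod_top L w hw (ϖu : w.1.adicCompletion L)
  have hsupp1 := support_hFamily_one_eq_coe_prod_top L w hw ϖu (K₂ 1) hK1mem
  -- the four heads of ★ p855773, by place type (§1: = parity of `d`) and profile
  rcases hvα₀ with hvα₀ | hvα₀
  · -- √u-type place: `d` even; `K₂` ↔ vertices, `K♯` ↔ edges
    have hd2 : d % 2 = 0 := mod_two_eq_zero_of_antiFixed_of_v_eq_one hD hα₀ hvα₀
    fin_cases s
    · obtain ⟨N', hΦ, hlaw⟩ := exists_hFamily_zero_eq_mul_two_mul_and_law_of_v_eq_one L v w hw hα₀ hα₀0 hϖF νH he hvα₀ (ϖu : w.1.adicCompletion L) hmH hreg hsplit hell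
        hs hsg hu hu1 hv1 hc hconj hγ₁ (one_mem _) hb hγ₁det hbn ⟨_, hx₀S⟩ rfl
      simp only [Fin.zero_eta, Fin.isValue]
      rw [hΦ, hsupp0, if_pos hd2.symm]
      rw [hqq] at hlaw hq2
      exact mul_two_mul_eq_affine_of_vertex_law hq2 hlaw _
    · obtain ⟨N', hΦ, hlaw⟩ := exists_hFamily_one_eq_mul_two_mul_and_law_of_v_eq_one L v w hw hα₀ hα₀0 hϖF νH he hvα₀ ϖu hϖ (K₂ 1) hK1mem (hKo 1) (hKc 1) hmH hreg hsplit hell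
        hs hsg hu hu1 hv1 hc hconj hγ₁ (one_mem _) hb hγ₁det hbn ⟨_, hx₀S⟩ rfl
      simp only [Fin.mk_one, Fin.isValue]
      rw [hΦ, hsupp1, if_neg (show (1 : ℕ) ≠ d % 2 by omega)]
      rw [hqq] at hlaw hq2
      exact mul_two_mul_eq_affine_of_edge_law hq2 hlaw _
  · -- √π-type place: `d` odd; `K₂` ↔ edges, `K♯` ↔ vertices
    have hd2 : d % 2 = 1 := mod_two_eq_one_of_antiFixed_of_v_eq_exp_neg_one hD hα₀ hvα₀
    fin_cases s
    · obtain ⟨N', hΦ, hlaw⟩ := exists_hFamily_zero_eq_mul_two_mul_and_law_of_v_eq_exp_neg_one L v w hw hα₀ hα₀0 hϖF νH he hvα₀ (ϖu : w.1.adicCompletion L) hmH hreg hsplit hell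
        hs hsg hu hu1 hv1 hc hconj hγ₁ (one_mem _) hb hγ₁det hbn ⟨_, hx₀S⟩ rfl
      simp only [Fin.zero_eta, Fin.isValue]
      rw [hΦ, hsupp0, if_neg (show (0 : ℕ) ≠ d % 2 by omega)]
      rw [hqq] at hlaw hq2
      exact mul_two_mul_eq_affine_of_edge_law hq2 hlaw _
    · obtain ⟨N', hΦ, hlaw⟩ := exists_hFamily_one_eq_mul_two_mul_and_law_of_v_eq_exp_neg_one L v w hw hα₀ hα₀0 hϖF νH he hvα₀ ϖu hϖ (K₂ 1) hK1mem (hKo 1) (hKc 1) hmH hreg hsplit hell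
        hs hsg hu hu1 hv1 hc hconj hγ₁ (one_mem _) hb hγ₁det hbn ⟨_, hx₀S⟩ rfl
      simp only [Fin.mk_one, Fin.isValue]
      rw [hΦ, hsupp1, if_pos hd2.symm]
      rw [hqq] at hlaw hq2
      exact mul_two_mul_eq_affine_of_vertex_law hq2 hlaw _

end Summit.HodgeConjecture.HodgeConjecture.Cruxes.H413.F0P3cDyRamHProfilesTypeOneAffineWild

end
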